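import Literature.MathematicalPhysics.QuantumChemistry.GroupLocalFormBound
import Summits.Ventures.CertifiedQuantumChemistry.Rows.SingletDeflatorRows
import HarnessLib

/-!
# Ventures/CertifiedQuantumChemistry — Rows/SingletDeflatorLocalRows.lean: the block-deflator `hSform`
# from LOCAL (per orbital group) occupation-resolved tops and a finite occupation table

HONEST FRAMING (verbatim): certified bounds for a stated model Hamiltonian in a stated basis; not a
claim about the real molecule or material beyond that model.

Typer chem-type-02 (LADDER-CHEM I-TYPE, (n2) supplier of door M1-OS; cell chem-oracle). Sibling of
`Rows/SingletDeflatorRows.lean` (p491858), whose per-occupation-class premise `hoff` («on every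
occupation class other than the top one the form of `Ĥ(S)` is `≤ c` on singlet-sector vectors») is a
statement over classes of dimension `~10⁸` at `k = 16`, discharged so far only by chem-idea-1's prose
(HYPOTHESES-M1OS.md (n2a)–(n2d); `solver/gap-temple/runs/blockcheck-exact/README.md` §4 «the Lean
discharge of hoff (tensor-block spectrum lemma) is a separate typed item»). THIS FILE discharges it in
the kernel from LOCAL data via the Literature lemma `groupLocal_form_le`
(`GroupLocalFormBound.lean`): for a deflator file `S : Model k` whose tables are group-LOCAL for an
orbital partition `grp` enumerated by order embeddings `φ i : Fin (m i) ↪o Fin k` —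
`S.h p q ≠ 0 ⇒ q ~ p`, `S.eri p q r s ≠ 0 ⇒ q ~ p ∧ r ~ p ∧ s ~ p` (decidable on the literal file;
true for the local-spin / Hund family `G_θ` and for sub-Hamiltonian deflators) — the premises become

* `hU` — LOCAL TOPS: for every group `i` and every `(a, b)` sector of the GROUP'S OWN Fock space
  (`4^{m i}`-dimensional; `m i = 4` ⇒ 256, sector blocks `≤ 36`),
  `Re⟨χ, Ĥ(S.restrict (φ i)) χ⟩ ≤ U_i(a + b)·‖χ‖²` — nine rational numbers per group, each an exact
  `LDLᵀ`/eigenvalue check the referee replays in seconds;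
* `htab` — the finite OCCUPATION TABLE: for every tuple `l ≠ t` of group occupations with
  `Σ_i l_i = 2n` and `l_i ≤ 2·m i`, `S.ecore + Σ_i U_i(l_i) ≤ c` (a few hundred rational inequalities);
* `htop` — unchanged: the top occupation class `t` (the WHOLE class, e.g. `(8,4,4,0)` = 1 810
  determinants at `M = 0`, not only the singly-occupied pattern) meets the singlet sector orthogonally
  to `u` with form `≤ c` — one explicit finite check (chem-idea-1 2026-08-27T04:29:50Z option (a); its
  spin-penalty SECTOR form is `SymmetricDeflation.lean` §4);
* `huT` — `u` (the reference CSF `Φ`) is supported in the top class.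

Conclusion: chem-type-09's `hSform` verbatim, hence (with the `DQG:flip` sector lower row `ℓ` of the
exact combined file `Model.lincomb 1 λ F S` and `0 ≤ λ`) `SingletGapCertificateCodimOne F n (ℓ − λc)`.
Numbers for the legs of record (θ_flat = famG4, `fam_flat1.json` 9da35825…; chem-type-02 /
chem-idea-1 2026-08-27): `U_DOCC(n) = n/4`, `U_VIRT(n) = −3n/4`, `U_A = U_B =
(0, 1, 7/4, 9/4, 5/2, 7/4, 3/4, −1/2, −2)` at `N = 0…8`, `e_core = −6`, `c = 0`: the table's maximum
over `l ≠ (8,4,4,0)` is `0` exactly. Nothing here asserts any of them.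

## Contents
* `Model.restrict S φ : Model m` — the group's own file (tables pulled back along `φ`, zero scalar);
  `Model.hamiltonian_restrict`.
* `Model.form_le_of_localBounds` — the tensor-block bound at a model: on the occupation class `l`,
  `Re⟨z, Ĥ(S) z⟩ ≤ (S.ecore + Σ_i U_i(l_i))·‖z‖²`.
* `Model.deflator_form_le_on_singlet_orth_of_localBounds` — `hSform` from (`hU`, `htab`, `htop`, `huT`).
* `Model.singletGapCertificateCodimOne_of_localDeflator{,_singlet}` — composed with chem-type-09's
  producer (`Rows/SingletGapCertificateCodimOne.lean`, p490432).
References: Verstichel et al. (2010) §2.3 [cite: VerstichelEtAl2010Subsystem, §2.3 eqs. (16)-(24)]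
(slicing mechanism); Horn–Johnson (2013) Cor. 4.3.9 [cite: HornJohnson2013, Cor. 4.3.9] (rank-one
deflation, through the imported producer).
-/

noncomputable section

namespace Summit.Ventures.CertifiedQuantumChemistry

open Matrix Finset
open Literature.MathematicalPhysics.QuantumLattice Literature.MathematicalPhysics.QuantumChemistry
open scoped ComplexOrder

variable {k : ℕ}

/-- **The restriction of a model to a sub-list of orbitals** `φ : Fin m ↪o Fin k`: the file of the
group's own Fock space, `h|_φ pq = h_{φp, φq}`, `(pq|rs)|_φ = (φp φq|φr φs)`, scalar `0` (the
"Hamiltonian defined in the subspace" of Verstichel et al. (2010) eqs. (22)–(23)).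
[cite: VerstichelEtAl2010Subsystem, §2.3 eqs. (22)-(23)] -/
def Model.restrict (S : Model k) {m : ℕ} (φ : Fin m ↪o Fin k) : Model m :=
  ⟨fun p q => S.h (φ p) (φ q), fun p q r s => S.eri (φ p) (φ q) (φ r) (φ s), 0⟩

/-- The restricted model's Hamiltonian is the molecular Hamiltonian of the pulled-back cast tables with
zero scalar. [cite: VerstichelEtAl2010Subsystem, §2.3 eqs. (22)-(23)] -/
theorem Model.hamiltonian_restrict (S : Model k) {m : ℕ} (φ : Fin m ↪o Fin k) :
    (S.restrict φ).hamiltonian =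
      molecularHamiltonian (fun p q => (S.h (φ p) (φ q) : ℂ))
        (fun p q r s => (S.eri (φ p) (φ q) (φ r) (φ s) : ℂ)) 0 := by
  unfold Model.hamiltonian Model.restrict
  simp only [Rat.cast_zero]

/-- A restricted symmetric model is symmetric (so its Hamiltonian is Hermitian). [cite: VerstichelEtAl2010Subsystem, §2.3 eqs. (22)-(23)] -/
theorem Model.IsSymmetric.restrict {S : Model k} (hS : S.IsSymmetric) {m : ℕ} (φ : Fin m ↪o Fin k) :
    (S.restrict φ).IsSymmetric :=
  ⟨fun _ _ => hS.1 _ _, fun _ _ _ _ => hS.2 _ _ _ _⟩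

/-- The group occupation label of the supplier files, `i ↦ Σ_{p∈s↑} 1[p ∈ i] + Σ_{p∈s↓} 1[p ∈ i]`, is
the cast of the natural-number occupation `|s↑ ∩ group i| + |s↓ ∩ group i|` (bookkeeping). [folklore] -/
private theorem occLabel_eq_cast {X : Type*} [DecidableEq X] (grp : Fin k → X) (s : Finset (Orb (Fin k)))
    (i : X) :
    (∑ p ∈ upPart s, (if grp p = i then (1 : ℝ) else 0)) +
        ∑ p ∈ downPart s, (if grp p = i then (1 : ℝ) else 0) =
      ((((upPart s).filter (fun p => grp p = i)).card +
        ((downPart s).filter (fun p => grp p = i)).card : ℕ) : ℝ) := by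
  rw [Finset.sum_boole, Finset.sum_boole, Nat.cast_add]

/-- **The tensor-block bound at a model.** For a file `S` with group-local tables and local
occupation-resolved tops `U_i` (`hU`, on the groups' own Fock spaces), on every occupation class `l`:
`Re⟨z, Ĥ(S) z⟩ ≤ (S.ecore + Σ_i U_i(l_i))·‖z‖²` (`groupLocal_form_le` at the cast tables).
[cite: VerstichelEtAl2010Subsystem, §2.3 eqs. (16)-(24)] -/
theorem Model.form_le_of_localBounds {X : Type*} [Fintype X] [DecidableEq X] (grp : Fin k → X)
    (m : X → ℕ) (φ : ∀ i, Fin (m i) ↪o Fin k) (hφ : ∀ i j, grp (φ i j) = i)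
    (hcov : ∀ i p, grp p = i → ∃ j, φ i j = p) (S : Model k)
    (hh : ∀ p q, S.h p q ≠ 0 → grp q = grp p)
    (hg : ∀ p q r s, S.eri p q r s ≠ 0 → grp q = grp p ∧ grp r = grp p ∧ grp s = grp p)
    (U : X → ℕ → ℚ)
    (hU : ∀ i a b (χ : Fock (Orb (Fin (m i)))), IsInSector a b χ →
      (star χ ⬝ᵥ (S.restrict (φ i)).hamiltonian *ᵥ χ).re ≤ ((U i (a + b) : ℚ) : ℝ) * (star χ ⬝ᵥ χ).re)
    (l : X → ℕ) (z : Fock (Orb (Fin k)))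
    (hz : ∀ s, (fun i => ((upPart s).filter (fun p => grp p = i)).card +
      ((downPart s).filter (fun p => grp p = i)).card) ≠ l → z s = 0) :
    (star z ⬝ᵥ S.hamiltonian *ᵥ z).re ≤
      ((S.ecore + ∑ i, U i (l i) : ℚ) : ℝ) * (star z ⬝ᵥ z).re := by
  have h := groupLocal_form_le grp m φ hφ hcov (fun p q => (S.h p q : ℂ))
    (fun p q r s => (S.eri p q r s : ℂ)) (S.ecore : ℂ)
    (fun p q hpq => hh p q fun h0 => hpq (by rw [h0, Rat.cast_zero]))
    (fun p q r s hpqrs => hg p q r s fun h0 => hpqrs (by rw [h0, Rat.cast_zero]))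
    (fun i N => ((U i N : ℚ) : ℝ)) (fun i a b χ hχ => by
      have h1 := hU i a b χ hχ
      rwa [Model.hamiltonian_restrict] at h1) l z hz
  have hre : ((S.ecore : ℚ) : ℂ).re = ((S.ecore : ℚ) : ℝ) := by
    rw [← Complex.ofReal_ratCast, Complex.ofReal_re]
  rw [Rat.cast_add, Rat.cast_sum]
  rw [hre] at h
  exact h

/-- **The block-deflator `hSform` from LOCAL premises** (HYPOTHESES-M1OS (n2a)–(n2d) in the kernel,
chem-idea-1 2026-08-27T04:29:50Z option (a)). Deflator file `S : Model k` with group-local tables for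
the partition `grp` (enumerated by `φ`); local occupation-resolved tops `U_i` on the groups' own Fock
spaces (`hU`); the finite occupation table away from the top tuple `t` (`htab`, restricted to tuples
of total `2n` within the group capacities); the top-class premise `htop` (whole top occupation class,
singlet sector, orthogonally to `u`) and `u` supported in the top class (`huT`) ⟹ for every
singlet-sector `x ⊥ u`, `Re⟨x, Ĥ(S)x⟩ ≤ c‖x‖²` — chem-type-09's `hSform` verbatim
(`Model.deflator_form_le_on_singlet_orth_of_groups` with its `hoff` DISCHARGED by
`Model.form_le_of_localBounds`). [cite: HornJohnson2013, Cor. 4.3.9] -/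
theorem Model.deflator_form_le_on_singlet_orth_of_localBounds {X : Type*} [Fintype X] [DecidableEq X]
    (grp : Fin k → X) (m : X → ℕ) (φ : ∀ i, Fin (m i) ↪o Fin k) (hφ : ∀ i j, grp (φ i j) = i)
    (hcov : ∀ i p, grp p = i → ∃ j, φ i j = p) (S : Model k)
    (hh : ∀ p q, S.h p q ≠ 0 → grp q = grp p)
    (hg : ∀ p q r s, S.eri p q r s ≠ 0 → grp q = grp p ∧ grp r = grp p ∧ grp s = grp p)
    (U : X → ℕ → ℚ)
    (hU : ∀ i a b (χ : Fock (Orb (Fin (m i)))), IsInSector a b χ →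
      (star χ ⬝ᵥ (S.restrict (φ i)).hamiltonian *ᵥ χ).re ≤ ((U i (a + b) : ℚ) : ℝ) * (star χ ⬝ᵥ χ).re)
    (t : X → ℕ) {c : ℚ} {n : ℕ} {u : Fock (Orb (Fin k))}
    (huT : ∀ s, (fun i => ∑ p ∈ upPart s, (if grp p = i then (1 : ℝ) else 0) +
      ∑ p ∈ downPart s, (if grp p = i then (1 : ℝ) else 0)) ≠ (fun i => (t i : ℝ)) → u s = 0)
    (htab : ∀ l : X → ℕ, l ≠ t → (∑ i, l i) = n + n → (∀ i, l i ≤ 2 * m i) →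
      S.ecore + ∑ i, U i (l i) ≤ c)
    (htop : ∀ y : Fock (Orb (Fin k)), IsInSector n n y → spinPlus *ᵥ y = 0 →
      (∀ s, (fun i => ∑ p ∈ upPart s, (if grp p = i then (1 : ℝ) else 0) +
        ∑ p ∈ downPart s, (if grp p = i then (1 : ℝ) else 0)) ≠ (fun i => (t i : ℝ)) → y s = 0) →
      star u ⬝ᵥ y = 0 →
      (star y ⬝ᵥ S.hamiltonian *ᵥ y).re ≤ ((c : ℚ) : ℝ) * (star y ⬝ᵥ y).re) :
    ∀ x : Fock (Orb (Fin k)), IsInSector n n x → spinPlus *ᵥ x = 0 → star u ⬝ᵥ x = 0 →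
      (star x ⬝ᵥ S.hamiltonian *ᵥ x).re ≤ ((c : ℚ) : ℝ) * (star x ⬝ᵥ x).re := by
  refine Model.deflator_form_le_on_singlet_orth_of_groups grp S (fun p q hpq => (hh p q hpq).symm)
    (fun p q r s hpqrs => ?_) (fun i => (t i : ℝ)) huT (fun l hl z hz _ hsupp => ?_) htop
  · obtain ⟨hq, hr, hs⟩ := hg p q r s hpqrs
    exact Or.inl ⟨hq.symm, hr.trans hs.symm⟩
  -- `hoff` on the class `l ≠ t`: empty classes and `z = 0` are trivial; otherwise read the class off a
  -- configuration in the support of `z` and apply the tensor-block bound and the table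
  by_cases h0 : z = 0
  · subst h0
    simp only [mulVec_zero, dotProduct_zero, Complex.zero_re, mul_zero, le_refl]
  obtain ⟨s₀, hs₀⟩ := Function.ne_iff.1 h0
  set lN : X → ℕ := fun i => ((upPart s₀).filter (fun p => grp p = i)).card +
    ((downPart s₀).filter (fun p => grp p = i)).card with hlN
  have hlab : ∀ s : Finset (Orb (Fin k)), (fun i => ∑ p ∈ upPart s, (if grp p = i then (1 : ℝ) else 0) +
      ∑ p ∈ downPart s, (if grp p = i then (1 : ℝ) else 0)) =
      fun i => ((((upPart s).filter (fun p => grp p = i)).card +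
        ((downPart s).filter (fun p => grp p = i)).card : ℕ) : ℝ) :=
    fun s => funext fun i => occLabel_eq_cast grp s i
  -- the class label `l` is the cast of the occupation tuple of `s₀`
  have hl₀ : l = fun i => (lN i : ℝ) := by
    by_contra hne
    exact hs₀ (hsupp s₀ (by rw [hlab s₀]; exact fun h => hne (h.symm.trans rfl)))
  -- `z` is supported on the occupation class `lN`
  have hz' : ∀ s, (fun i => ((upPart s).filter (fun p => grp p = i)).card +
      ((downPart s).filter (fun p => grp p = i)).card) ≠ lN → z s = 0 := by
    intro s hs
    refine hsupp s ?_
    rw [hlab s, hl₀]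
    intro h
    exact hs (funext fun i => Nat.cast_injective (R := ℝ) (congrFun h i))
  have hform := Model.form_le_of_localBounds grp m φ hφ hcov S hh hg U hU lN z hz'
  -- the table: `lN ≠ t`, total occupation `2n`, within the group capacities
  have hlt : lN ≠ t := by
    intro h
    exact hl (by rw [hl₀, h])
  have hsum : (∑ i, lN i) = n + n := sum_grp_occupation_eq grp hz hs₀
  have hcap : ∀ i, lN i ≤ 2 * m i := fun i => grp_occupation_le grp m φ hφ hcov i s₀
  have htab' : ((S.ecore + ∑ i, U i (lN i) : ℚ) : ℝ) ≤ ((c : ℚ) : ℝ) :=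
    Rat.cast_le.2 (htab lN hlt hsum hcap)
  have hzz : 0 ≤ (star z ⬝ᵥ z).re := (Complex.nonneg_iff.1 (dotProduct_star_self_nonneg z)).1
  exact hform.trans (mul_le_mul_of_nonneg_right htab' hzz)

/-- **(n1)+(n2a–d)+(n3) ⇒ (G) with LOCAL (n2) premises.** Symmetric `F` (the file) and `S` (the
deflator file with group-local tables), local tops `hU`, occupation table `htab`, top-class premise
`htop`, `u` in the top class, sector lower row `ℓ` of the exact combined file `Model.lincomb 1 λ F S`,
`0 ≤ λ` ⟹ `SingletGapCertificateCodimOne F n (ℓ − λc)` (chem-type-09's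
`singletGapCertificateCodimOne_of_lowerRow_shift`, p490432). [cite: HornJohnson2013, Cor. 4.3.9] -/
theorem Model.singletGapCertificateCodimOne_of_localDeflator {X : Type*} [Fintype X] [DecidableEq X]
    (grp : Fin k → X) (m : X → ℕ) (φ : ∀ i, Fin (m i) ↪o Fin k) (hφ : ∀ i j, grp (φ i j) = i)
    (hcov : ∀ i p, grp p = i → ∃ j, φ i j = p) {F S : Model k} (hF : F.IsSymmetric)
    (hS : S.IsSymmetric)
    (hh : ∀ p q, S.h p q ≠ 0 → grp q = grp p)
    (hg : ∀ p q r s, S.eri p q r s ≠ 0 → grp q = grp p ∧ grp r = grp p ∧ grp s = grp p)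
    (U : X → ℕ → ℚ)
    (hU : ∀ i a b (χ : Fock (Orb (Fin (m i)))), IsInSector a b χ →
      (star χ ⬝ᵥ (S.restrict (φ i)).hamiltonian *ᵥ χ).re ≤ ((U i (a + b) : ℚ) : ℝ) * (star χ ⬝ᵥ χ).re)
    (t : X → ℕ) {c : ℚ} {n : ℕ} {u : Fock (Orb (Fin k))}
    (huT : ∀ s, (fun i => ∑ p ∈ upPart s, (if grp p = i then (1 : ℝ) else 0) +
      ∑ p ∈ downPart s, (if grp p = i then (1 : ℝ) else 0)) ≠ (fun i => (t i : ℝ)) → u s = 0)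
    (htab : ∀ l : X → ℕ, l ≠ t → (∑ i, l i) = n + n → (∀ i, l i ≤ 2 * m i) →
      S.ecore + ∑ i, U i (l i) ≤ c)
    (htop : ∀ y : Fock (Orb (Fin k)), IsInSector n n y → spinPlus *ᵥ y = 0 →
      (∀ s, (fun i => ∑ p ∈ upPart s, (if grp p = i then (1 : ℝ) else 0) +
        ∑ p ∈ downPart s, (if grp p = i then (1 : ℝ) else 0)) ≠ (fun i => (t i : ℝ)) → y s = 0) →
      star u ⬝ᵥ y = 0 →
      (star y ⬝ᵥ S.hamiltonian *ᵥ y).re ≤ ((c : ℚ) : ℝ) * (star y ⬝ᵥ y).re)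
    {lam : ℚ} (hlam : 0 ≤ lam) {ℓ : ℚ} (hL : LowerRow (Model.lincomb 1 lam F S) n n ℓ) :
    SingletGapCertificateCodimOne F n (ℓ - lam * c) :=
  singletGapCertificateCodimOne_of_lowerRow_shift hF hS hlam u
    (Model.deflator_form_le_on_singlet_orth_of_localBounds grp m φ hφ hcov S hh hg U hU t huT htab htop)
    hL

/-- The same with the SINGLET lower row of the combined file as the leg (`:s2=0` kind; chem-type-09's
`singletGapCertificateCodimOne_of_singletLowerRow_shift`). [cite: HornJohnson2013, Cor. 4.3.9] -/
theorem Model.singletGapCertificateCodimOne_of_localDeflator_singlet {X : Type*} [Fintype X]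
    [DecidableEq X] (grp : Fin k → X) (m : X → ℕ) (φ : ∀ i, Fin (m i) ↪o Fin k)
    (hφ : ∀ i j, grp (φ i j) = i) (hcov : ∀ i p, grp p = i → ∃ j, φ i j = p) {F S : Model k}
    (hF : F.IsSymmetric) (hS : S.IsSymmetric)
    (hh : ∀ p q, S.h p q ≠ 0 → grp q = grp p)
    (hg : ∀ p q r s, S.eri p q r s ≠ 0 → grp q = grp p ∧ grp r = grp p ∧ grp s = grp p)
    (U : X → ℕ → ℚ)
    (hU : ∀ i a b (χ : Fock (Orb (Fin (m i)))), IsInSector a b χ →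
      (star χ ⬝ᵥ (S.restrict (φ i)).hamiltonian *ᵥ χ).re ≤ ((U i (a + b) : ℚ) : ℝ) * (star χ ⬝ᵥ χ).re)
    (t : X → ℕ) {c : ℚ} {n : ℕ} {u : Fock (Orb (Fin k))}
    (huT : ∀ s, (fun i => ∑ p ∈ upPart s, (if grp p = i then (1 : ℝ) else 0) +
      ∑ p ∈ downPart s, (if grp p = i then (1 : ℝ) else 0)) ≠ (fun i => (t i : ℝ)) → u s = 0)
    (htab : ∀ l : X → ℕ, l ≠ t → (∑ i, l i) = n + n → (∀ i, l i ≤ 2 * m i) →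
      S.ecore + ∑ i, U i (l i) ≤ c)
    (htop : ∀ y : Fock (Orb (Fin k)), IsInSector n n y → spinPlus *ᵥ y = 0 →
      (∀ s, (fun i => ∑ p ∈ upPart s, (if grp p = i then (1 : ℝ) else 0) +
        ∑ p ∈ downPart s, (if grp p = i then (1 : ℝ) else 0)) ≠ (fun i => (t i : ℝ)) → y s = 0) →
      star u ⬝ᵥ y = 0 →
      (star y ⬝ᵥ S.hamiltonian *ᵥ y).re ≤ ((c : ℚ) : ℝ) * (star y ⬝ᵥ y).re)
    {lam : ℚ} (hlam : 0 ≤ lam) {ℓ : ℚ} (hL : SingletLowerRow (Model.lincomb 1 lam F S) n ℓ) :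
    SingletGapCertificateCodimOne F n (ℓ - lam * c) :=
  singletGapCertificateCodimOne_of_singletLowerRow_shift hF hS hlam u
    (Model.deflator_form_le_on_singlet_orth_of_localBounds grp m φ hφ hcov S hh hg U hU t huT htab htop)
    hL


/-! ## Spin-penalty SECTOR form of the top-class premise (chem-idea-1 2026-08-27T04:29:50Z)

The top occupation class of a local-spin deflator carries every total spin of its labels; `htop` asks
for the bound on its SINGLET-sector part orthogonally to `u`. Reader-side this is most cheaply certified
on the PLAIN `(n, n)`-sector block of the class, with a spin penalty and a rank-one relaxation:
«`c·1 − (Ĥ(S) − μ Ŝ₊ᴴŜ₊)|_class + ν |u⟩⟨u| ⪰ 0`» (exact `LDLᵀ`; `Ŝ₊ᴴŜ₊ = Ŝ²` on `M = 0`; no kernel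
basis of `Ŝ₊`, no Clebsch–Gordan rule) — `SymmetricDeflation.lean` §4 (`htop_of_spinPenalty`,
`htop_of_rankOne`, p497446) turns that form statement into `htop`. -/

/-- **`hSform` from LOCAL premises with the top class certified in spin-penalty SECTOR form.** As
`Model.deflator_form_le_on_singlet_orth_of_localBounds`, with `htop` replaced by `htopPen`: for some
`μ : ℂ` and `ν : ℝ`, every `(n, n)`-sector vector `y` supported in the top occupation class satisfies
`Re⟨y, (Ĥ(S) − μ Ŝ₊ᴴŜ₊) y⟩ ≤ c‖y‖² + ν |⟨u, y⟩|²` (the form of the exact block certificate on the plain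
class). [cite: HornJohnson2013, Cor. 4.3.9] -/
theorem Model.deflator_form_le_on_singlet_orth_of_localBounds_spinPenalty {X : Type*} [Fintype X]
    [DecidableEq X] (grp : Fin k → X) (m : X → ℕ) (φ : ∀ i, Fin (m i) ↪o Fin k)
    (hφ : ∀ i j, grp (φ i j) = i) (hcov : ∀ i p, grp p = i → ∃ j, φ i j = p) (S : Model k)
    (hh : ∀ p q, S.h p q ≠ 0 → grp q = grp p)
    (hg : ∀ p q r s, S.eri p q r s ≠ 0 → grp q = grp p ∧ grp r = grp p ∧ grp s = grp p)
    (U : X → ℕ → ℚ)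
    (hU : ∀ i a b (χ : Fock (Orb (Fin (m i)))), IsInSector a b χ →
      (star χ ⬝ᵥ (S.restrict (φ i)).hamiltonian *ᵥ χ).re ≤ ((U i (a + b) : ℚ) : ℝ) * (star χ ⬝ᵥ χ).re)
    (t : X → ℕ) {c : ℚ} {n : ℕ} {u : Fock (Orb (Fin k))}
    (huT : ∀ s, (fun i => ∑ p ∈ upPart s, (if grp p = i then (1 : ℝ) else 0) +
      ∑ p ∈ downPart s, (if grp p = i then (1 : ℝ) else 0)) ≠ (fun i => (t i : ℝ)) → u s = 0)
    (htab : ∀ l : X → ℕ, l ≠ t → (∑ i, l i) = n + n → (∀ i, l i ≤ 2 * m i) →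
      S.ecore + ∑ i, U i (l i) ≤ c)
    (μ : ℂ) (ν : ℝ)
    (htopPen : ∀ y : Fock (Orb (Fin k)), IsInSector n n y →
      (∀ s, (fun i => ∑ p ∈ upPart s, (if grp p = i then (1 : ℝ) else 0) +
        ∑ p ∈ downPart s, (if grp p = i then (1 : ℝ) else 0)) ≠ (fun i => (t i : ℝ)) → y s = 0) →
      (star y ⬝ᵥ (S.hamiltonian - μ • (spinPlusᴴ * spinPlus)) *ᵥ y).re ≤
        ((c : ℚ) : ℝ) * (star y ⬝ᵥ y).re + ν * ‖star u ⬝ᵥ y‖ ^ 2) :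
    ∀ x : Fock (Orb (Fin k)), IsInSector n n x → spinPlus *ᵥ x = 0 → star u ⬝ᵥ x = 0 →
      (star x ⬝ᵥ S.hamiltonian *ᵥ x).re ≤ ((c : ℚ) : ℝ) * (star x ⬝ᵥ x).re :=
  Model.deflator_form_le_on_singlet_orth_of_localBounds grp m φ hφ hcov S hh hg U hU t huT htab
    (htop_of_spinPenalty μ (htop_of_rankOne htopPen))

/-- **(G) with LOCAL premises and the spin-penalty top-class certificate**, sector `LowerRow` leg of
the exact combined file `Model.lincomb 1 λ F S`. [cite: HornJohnson2013, Cor. 4.3.9] -/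
theorem Model.singletGapCertificateCodimOne_of_localDeflator_spinPenalty {X : Type*} [Fintype X]
    [DecidableEq X] (grp : Fin k → X) (m : X → ℕ) (φ : ∀ i, Fin (m i) ↪o Fin k)
    (hφ : ∀ i j, grp (φ i j) = i) (hcov : ∀ i p, grp p = i → ∃ j, φ i j = p) {F S : Model k}
    (hF : F.IsSymmetric) (hS : S.IsSymmetric)
    (hh : ∀ p q, S.h p q ≠ 0 → grp q = grp p)
    (hg : ∀ p q r s, S.eri p q r s ≠ 0 → grp q = grp p ∧ grp r = grp p ∧ grp s = grp p)
    (U : X → ℕ → ℚ)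
    (hU : ∀ i a b (χ : Fock (Orb (Fin (m i)))), IsInSector a b χ →
      (star χ ⬝ᵥ (S.restrict (φ i)).hamiltonian *ᵥ χ).re ≤ ((U i (a + b) : ℚ) : ℝ) * (star χ ⬝ᵥ χ).re)
    (t : X → ℕ) {c : ℚ} {n : ℕ} {u : Fock (Orb (Fin k))}
    (huT : ∀ s, (fun i => ∑ p ∈ upPart s, (if grp p = i then (1 : ℝ) else 0) +
      ∑ p ∈ downPart s, (if grp p = i then (1 : ℝ) else 0)) ≠ (fun i => (t i : ℝ)) → u s = 0)
    (htab : ∀ l : X → ℕ, l ≠ t → (∑ i, l i) = n + n → (∀ i, l i ≤ 2 * m i) →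
      S.ecore + ∑ i, U i (l i) ≤ c)
    (μ : ℂ) (ν : ℝ)
    (htopPen : ∀ y : Fock (Orb (Fin k)), IsInSector n n y →
      (∀ s, (fun i => ∑ p ∈ upPart s, (if grp p = i then (1 : ℝ) else 0) +
        ∑ p ∈ downPart s, (if grp p = i then (1 : ℝ) else 0)) ≠ (fun i => (t i : ℝ)) → y s = 0) →
      (star y ⬝ᵥ (S.hamiltonian - μ • (spinPlusᴴ * spinPlus)) *ᵥ y).re ≤
        ((c : ℚ) : ℝ) * (star y ⬝ᵥ y).re + ν * ‖star u ⬝ᵥ y‖ ^ 2)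
    {lam : ℚ} (hlam : 0 ≤ lam) {ℓ : ℚ} (hL : LowerRow (Model.lincomb 1 lam F S) n n ℓ) :
    SingletGapCertificateCodimOne F n (ℓ - lam * c) :=
  singletGapCertificateCodimOne_of_lowerRow_shift hF hS hlam u
    (Model.deflator_form_le_on_singlet_orth_of_localBounds_spinPenalty grp m φ hφ hcov S hh hg U hU t
      huT htab μ ν htopPen) hL

/-- The same with the SINGLET lower row of the combined file as the leg. [cite: HornJohnson2013, Cor. 4.3.9] -/
theorem Model.singletGapCertificateCodimOne_of_localDeflator_spinPenalty_singlet {X : Type*}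
    [Fintype X] [DecidableEq X] (grp : Fin k → X) (m : X → ℕ) (φ : ∀ i, Fin (m i) ↪o Fin k)
    (hφ : ∀ i j, grp (φ i j) = i) (hcov : ∀ i p, grp p = i → ∃ j, φ i j = p) {F S : Model k}
    (hF : F.IsSymmetric) (hS : S.IsSymmetric)
    (hh : ∀ p q, S.h p q ≠ 0 → grp q = grp p)
    (hg : ∀ p q r s, S.eri p q r s ≠ 0 → grp q = grp p ∧ grp r = grp p ∧ grp s = grp p)
    (U : X → ℕ → ℚ)
    (hU : ∀ i a b (χ : Fock (Orb (Fin (m i)))), IsInSector a b χ →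
      (star χ ⬝ᵥ (S.restrict (φ i)).hamiltonian *ᵥ χ).re ≤ ((U i (a + b) : ℚ) : ℝ) * (star χ ⬝ᵥ χ).re)
    (t : X → ℕ) {c : ℚ} {n : ℕ} {u : Fock (Orb (Fin k))}
    (huT : ∀ s, (fun i => ∑ p ∈ upPart s, (if grp p = i then (1 : ℝ) else 0) +
      ∑ p ∈ downPart s, (if grp p = i then (1 : ℝ) else 0)) ≠ (fun i => (t i : ℝ)) → u s = 0)
    (htab : ∀ l : X → ℕ, l ≠ t → (∑ i, l i) = n + n → (∀ i, l i ≤ 2 * m i) →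
      S.ecore + ∑ i, U i (l i) ≤ c)
    (μ : ℂ) (ν : ℝ)
    (htopPen : ∀ y : Fock (Orb (Fin k)), IsInSector n n y →
      (∀ s, (fun i => ∑ p ∈ upPart s, (if grp p = i then (1 : ℝ) else 0) +
        ∑ p ∈ downPart s, (if grp p = i then (1 : ℝ) else 0)) ≠ (fun i => (t i : ℝ)) → y s = 0) →
      (star y ⬝ᵥ (S.hamiltonian - μ • (spinPlusᴴ * spinPlus)) *ᵥ y).re ≤
        ((c : ℚ) : ℝ) * (star y ⬝ᵥ y).re + ν * ‖star u ⬝ᵥ y‖ ^ 2)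
    {lam : ℚ} (hlam : 0 ≤ lam) {ℓ : ℚ} (hL : SingletLowerRow (Model.lincomb 1 lam F S) n ℓ) :
    SingletGapCertificateCodimOne F n (ℓ - lam * c) :=
  singletGapCertificateCodimOne_of_singletLowerRow_shift hF hS hlam u
    (Model.deflator_form_le_on_singlet_orth_of_localBounds_spinPenalty grp m φ hφ hcov S hh hg U hU t
      huT htab μ ν htopPen) hL

end Summit.Ventures.CertifiedQuantumChemistry

end
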